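import Mathlib
import Literature.AlgebraicGeometry.Resolution.CentreLocalRingLemmas
import Summits.ResolutionOfSingularities.ResolutionOfSingularities.Theorems.WeightedInvariantDescentPerfectToAllConstantQuotientRegular
import HarnessLib

/-!
# Crux `LogCanQuotLU` (stmt-ResolutionOfSingularities-17082), line `birth`:
# stub `stub_nonsingularDescent` — non-singular quotients by `p`-closed derivations are regular

Route `ResolutionOfSingularities/FoliationDescent`, crux #3 `LogCanQuotLU`, skeleton
`Cruxes/LogCanQuotLU/Lines/birth.lean`, stub `stub_nonsingularDescent` (the half of the crux that
is KNOWN in print: Rudakov–Shafarevich 1976, Thm. 1; Aramova–Avramov 1986, §1; Posva,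
arXiv:2311.16694, Lemma p. 12), PROVED here with the registered signature verbatim.

**Statement.** `k` a field of characteristic `p`, `K ⊇ k` a field, `O` a valuation ring of `K`,
`S' ≤ O` a `k`-subalgebra whose local ring `S'_c` at the centre of `O` is regular, `D` a
`p`-closed `k`-derivation of `K` (`D^p = c·D`), `g ≠ 0` such that `g • D` preserves `S'_c`
(membership in `S'_c` being spelled `∃ a b, a ∈ S' ∧ b ∈ S' ∧ b ≠ 0 ∧ b⁻¹ ∈ O ∧ x = a / b`) and
is NON-SINGULAR there (`(g • D) x₀` is a unit of `O` for some `x₀ ∈ S'_c`). Then the subalgebra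
`A = S' ∩ ker D` of constants is regular at the centre of `O`.

**Proof (plumbing around the landed abstract core).**
* `S'_c` is the explicit subalgebra `centreLocalRing O S' ⊆ K` (fractions `a / b`, `a, b ∈ S'`,
  `|b| = 1`; for `b ∈ S' ⊆ O`, `b ≠ 0 ∧ b⁻¹ ∈ O ↔ |b| = 1`), and regularity of
  `Localization.AtPrime (𝔪_O ∩ S')` is regularity of this subring
  (`Literature.AlgebraicGeometry.Resolution.isRegularLocalRing_centre_iff`).
* Rescale ON THE FIELD: `δ := w • D`, `w = ((g • D) x₀)⁻¹ g`, has `δ x₀ = 1`; by Hochschild's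
  formula (`Literature.RingTheory.FormalGroups.iterate_prime_smul_apply`) and `D^p = c D`,
  `δ^p = b · D` with `b · D x₀ = δ^{p-1}(δ x₀) = δ^{p-1} 1 = 0`, so `δ^p = 0` on `K`.
* `δ` preserves `R := centreLocalRing O S'` (`((g•D) x₀)⁻¹ ∈ R` because `(g • D) x₀ = a/b ∈ R`
  is a unit of `O`, so `|a| = 1`), hence restricts to a `ℤ`-derivation `δ_R` of `R` with
  `δ_R x₀ = 1`, `δ_R^p = 0`; the landed core
  `Summit.….Theorems.ConstantQuotientRegular.isRegularLocalRing_of_nilpotent` (Taylor lemma +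
  faithfully flat descent of regularity) gives that the subring `ker δ_R ⊆ R` is regular.
* `ker δ_R = centreLocalRing O A` as subsets of `K`: a fraction of constants is a constant, and a
  constant `z = s/t` (`s, t ∈ S'`, `|t| = 1`) equals `(z t^p)/t^p` with `t^p`, `z t^p = s t^{p-1}`
  constants in `S'`. Transport regularity along the resulting ring isomorphism
  (`IsRegularLocalRing.of_ringEquiv`) and back to `Localization.AtPrime (𝔪_O ∩ A)`.

The hypotheses `S'.FG`, `IsFractionRing S' K`, `D ≠ 0` of the registered statement are idle.
No new definitions; Mathlib used: `Derivation.mk'`, `AddMonoidHom.toIntLinearMap`,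
`Derivation.leibniz`, `Derivation.leibniz_pow`, `CharP.cast_eq_zero`, `CharP.subring'`,
`charP_of_injective_algebraMap`, `IsRegularLocalRing.of_ringEquiv`,
`ValuationSubring.valuation_le_one_iff`; in-tree: `centreLocalRing`, `isRegularLocalRing_centre_iff`,
`inv_mem_centreLocalRing`, `div_mem_centreLocalRing`, `ne_zero_of_valuation_eq_one`
(`Literature/AlgebraicGeometry/Resolution`), `iterate_prime_smul_apply`, `iterate_succ_apply_one`
(`Literature/RingTheory/FormalGroups/HochschildFormulaProofs`),
`ConstantQuotientRegular.isRegularLocalRing_of_nilpotent`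
(`Theorems/WeightedInvariantDescentPerfectToAllConstantQuotientRegular`).
-/

set_option linter.dupNamespace false -- single-problem summit: doubled namespace component is forced

noncomputable section

open IsLocalRing Literature.AlgebraicGeometry.Resolution

namespace Summit.ResolutionOfSingularities.ResolutionOfSingularities.Theorems

namespace NonsingularDescent

variable {k K : Type} [Field k] [Field K] [Algebra k K]

/-- An element of a valuation ring whose inverse also lies in the valuation ring has value `1`.
[folklore] -/
theorem valuation_eq_one_of_inv_mem {O : ValuationSubring K} {b : K} (hb : b ∈ O)
    (hbi : b⁻¹ ∈ O) (hb0 : b ≠ 0) : O.valuation b = 1 := by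
  have hb1 : O.valuation b ≤ 1 := (O.valuation_le_one_iff b).mpr hb
  have hbi1 : O.valuation b⁻¹ ≤ 1 := (O.valuation_le_one_iff _).mpr hbi
  refine le_antisymm hb1 ?_
  calc (1 : _) = O.valuation b * O.valuation b⁻¹ := by
        rw [← map_mul, mul_inv_cancel₀ hb0, map_one]
    _ ≤ O.valuation b * 1 := mul_le_mul_right hbi1 _
    _ = O.valuation b := mul_one _

/-- **Bridge of spellings**: the crux's membership in the local ring `S'_c` of `S' ⊆ O` at the
centre of `O` (`x = a / b`, `a, b ∈ S'`, `b ≠ 0`, `b⁻¹ ∈ O`) is membership in the explicit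
subalgebra `centreLocalRing O S'` (`x = a / b`, `a, b ∈ S'`, `|b| = 1`). [folklore] -/
theorem exists_iff_mem_centreLocalRing {O : ValuationSubring K} {S' : Subalgebra k K}
    (h' : S'.toSubring ≤ O.toSubring) (x : K) :
    (∃ a b : K, a ∈ S' ∧ b ∈ S' ∧ b ≠ 0 ∧ b⁻¹ ∈ O ∧ x = a / b) ↔ x ∈ centreLocalRing O S' := by
  constructor
  · rintro ⟨a, b, ha, hb, hb0, hbi, rfl⟩
    exact ⟨a, ha, b, hb, valuation_eq_one_of_inv_mem (h' hb) hbi hb0, rfl⟩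
  · rintro ⟨a, ha, b, hb, hb1, rfl⟩
    refine ⟨a, b, ha, hb, ne_zero_of_valuation_eq_one hb1, ?_, rfl⟩
    rw [← O.valuation_le_one_iff, map_inv₀, hb1, inv_one]

/-- A `k`-derivation of `K` preserving (the image of) a ring `R ↪ K` restricts to a
(`ℤ`-)derivation of `R`. [folklore] -/
theorem exists_derivation_restrict {R : Type*} [CommRing R] (f : R →+* K)
    (hf : Function.Injective f) (δ : Derivation k K K) (h : ∀ z : R, ∃ z' : R, f z' = δ (f z)) :
    ∃ δR : Derivation ℤ R R, ∀ z : R, f (δR z) = δ (f z) := by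
  choose F hF using h
  let φ : R →+ R :=
    { toFun := F
      map_zero' := hf (by rw [hF, map_zero, map_zero])
      map_add' := fun a b => hf (by rw [hF, map_add, map_add, map_add, hF, hF]) }
  refine ⟨Derivation.mk' φ.toIntLinearMap fun a b => hf ?_, hF⟩
  change f (F (a * b)) = f (a • F b + b • F a)
  rw [hF, map_mul, Derivation.leibniz, smul_eq_mul, smul_eq_mul, smul_eq_mul, smul_eq_mul,
    map_add, map_mul, map_mul, hF, hF]

/-- The constants of a derivation form a subring. [folklore] -/
theorem exists_subring_mem_iff {R : Type*} [CommRing R] (δ : Derivation ℤ R R) :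
    ∃ S : Subring R, ∀ y : R, y ∈ S ↔ δ y = 0 :=
  ⟨{ carrier := {y | δ y = 0}
     mul_mem' := fun {a b} (ha : δ a = 0) (hb : δ b = 0) => show δ (a * b) = 0 by
       rw [Derivation.leibniz, ha, hb, smul_zero, smul_zero, add_zero]
     one_mem' := δ.map_one_eq_zero
     add_mem' := fun {a b} (ha : δ a = 0) (hb : δ b = 0) => show δ (a + b) = 0 by
       rw [map_add, ha, hb, add_zero]
     zero_mem' := map_zero δ
     neg_mem' := fun {a} (ha : δ a = 0) => show δ (-a) = 0 by rw [map_neg, ha, neg_zero] },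
    fun _ => Iff.rfl⟩

end NonsingularDescent

open NonsingularDescent in
/-- **Stub `stub_nonsingularDescent` of crux `LogCanQuotLU`, line `birth` — non-singular
quotients are regular** (registered signature verbatim). In the situation of the crux (`S' ≤ O`
regular at the centre of the valuation ring `O`, `D` a `p`-closed `k`-derivation of `K`, `g ≠ 0`
with `g • D` preserving the local ring `S'_c`) and in the NON-SINGULAR case (`(g • D) x₀` a unit of
`O` for some `x₀ ∈ S'_c`), the subalgebra `A = S' ∩ ker D` is regular at the centre of `O`.
Proof: identify `S'_c` with `centreLocalRing O S' ⊆ K`; rescale `δ = ((g•D) x₀)⁻¹ g • D` on `K`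
(`δ x₀ = 1`, `δ^p = 0` by Hochschild's formula and `p`-closedness); restrict `δ` to `S'_c` and
apply the landed Taylor-lemma/flat-descent core
`ConstantQuotientRegular.isRegularLocalRing_of_nilpotent` to get `(S'_c)^δ` regular; finally
`(S'_c)^δ = centreLocalRing O A` inside `K` (`z = s/t = (z t^p)/t^p`).
[cite: AramovaAvramov1986, §1] [cite: RudakovShafarevich1976, Thm. 1]
[cite: Posva2023, Lemma p. 12] -/
theorem stub_nonsingularDescent :
  ∀ p : ℕ, p.Prime → ∀ (k K : Type) [Field k] [CharP k p] [Field K] [Algebra k K]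
    (O : ValuationSubring K) (S' : Subalgebra k K) (h' : S'.toSubring ≤ O.toSubring)
    (D : Derivation k K K) (g : K) (A : Subalgebra k K) (hA : A.toSubring ≤ O.toSubring),
    S'.FG → IsFractionRing S' K →
    IsRegularLocalRing
      (Localization.AtPrime (Ideal.comap (Subring.inclusion h') (IsLocalRing.maximalIdeal O))) →
    D ≠ 0 → (∃ c : K, ∀ x : K, (⇑D)^[p] x = c * D x) → g ≠ 0 →
    (∀ x : K, (∃ a b : K, a ∈ S' ∧ b ∈ S' ∧ b ≠ 0 ∧ b⁻¹ ∈ O ∧ x = a / b) →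
      ∃ a b : K, a ∈ S' ∧ b ∈ S' ∧ b ≠ 0 ∧ b⁻¹ ∈ O ∧ (g • D) x = a / b) →
    (∃ x : K, (∃ a b : K, a ∈ S' ∧ b ∈ S' ∧ b ≠ 0 ∧ b⁻¹ ∈ O ∧ x = a / b) ∧
      (g • D) x ≠ 0 ∧ ((g • D) x)⁻¹ ∈ O) →
    (∀ x : K, x ∈ A ↔ (x ∈ S' ∧ D x = 0)) →
    IsRegularLocalRing
      (Localization.AtPrime (Ideal.comap (Subring.inclusion hA) (IsLocalRing.maximalIdeal O))) := by
  intro p hp k K _ _ _ _ O S' h' D g A hA _hfg _hfrac hreg _hD hpc hg hpres hns hchar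
  haveI : Fact p.Prime := ⟨hp⟩
  have hp2 : 2 ≤ p := hp.two_le
  haveI : CharP K p := charP_of_injective_algebraMap (algebraMap k K).injective p
  -- (1) the local ring `S'_c = centreLocalRing O S' ⊆ K`, regular by hypothesis
  have hmem : ∀ x : K, (∃ a b : K, a ∈ S' ∧ b ∈ S' ∧ b ≠ 0 ∧ b⁻¹ ∈ O ∧ x = a / b) ↔
      x ∈ centreLocalRing O S' := exists_iff_mem_centreLocalRing h'
  haveI hRreg : IsRegularLocalRing (centreLocalRing O S') :=
    (isRegularLocalRing_centre_iff S' h').mp hreg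
  haveI : CharP (centreLocalRing O S') p := CharP.subring' K p (centreLocalRing O S').toSubring
  have hgD : ∀ y : K, (g • D) y = g * D y := fun y => by
    rw [Derivation.smul_apply, smul_eq_mul]
  -- (2) the non-singular point `x₀`: `v = (g • D) x₀` is a unit of `O`, and `v⁻¹ ∈ S'_c`
  obtain ⟨x₀, hx₀, hv0, hvi⟩ := hns
  have hx₀R : x₀ ∈ centreLocalRing O S' := (hmem x₀).mp hx₀
  have hDx₀ : D x₀ ≠ 0 := by
    intro h0
    apply hv0
    rw [hgD, h0, mul_zero]
  have hvinvR : ((g • D) x₀)⁻¹ ∈ centreLocalRing O S' := by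
    obtain ⟨a, b, ha, hb, hb0, hbi, hab⟩ := hpres x₀ hx₀
    have ha0 : a ≠ 0 := by
      rintro rfl
      rw [zero_div] at hab
      exact hv0 hab
    have ha1 : O.valuation a = 1 := by
      refine valuation_eq_one_of_inv_mem (h' ha) ?_ ha0
      have h1 : a = (g • D) x₀ * b := by rw [hab, div_mul_cancel₀ a hb0]
      rw [h1, mul_inv]
      exact O.mul_mem _ _ hvi hbi
    rw [hab]
    exact inv_mem_centreLocalRing ha hb ha1
  -- (3) the rescaled derivation `w • D`, `w = v⁻¹ g`, on `K`: slice `x₀`, nilpotent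
  obtain ⟨w, hw⟩ : ∃ w : K, w = ((g • D) x₀)⁻¹ * g := ⟨_, rfl⟩
  have hwD : ∀ y : K, (w • D) y = w * D y := fun y => by
    rw [Derivation.smul_apply, smul_eq_mul]
  have hwne : w ≠ 0 := by
    rw [hw]
    exact mul_ne_zero (inv_ne_zero hv0) hg
  have hδx₀ : (w • D) x₀ = 1 := by
    rw [hwD, hw, mul_assoc, ← hgD]
    exact inv_mul_cancel₀ hv0
  obtain ⟨c, hc⟩ := hpc
  have hnil : ∀ y : K, (⇑(w • D))^[p] y = 0 := by
    have hb : ∀ y : K, (⇑(w • D))^[p] y = (w ^ p * c + (⇑(w • D))^[p - 1] w) * D y := fun y => by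
      rw [Literature.RingTheory.FormalGroups.iterate_prime_smul_apply p D w y, hc y]
      ring
    have h1 : (⇑(w • D))^[p] x₀ = 0 := by
      rw [show p = p - 2 + 1 + 1 by omega, Function.iterate_succ_apply, hδx₀]
      exact Literature.RingTheory.FormalGroups.iterate_succ_apply_one _ _
    have hb0 : w ^ p * c + (⇑(w • D))^[p - 1] w = 0 := by
      have h2 := hb x₀
      rw [h1] at h2
      exact (mul_eq_zero.mp h2.symm).resolve_right hDx₀
    intro y
    rw [hb y, hb0, zero_mul]
  -- (4) `w • D` preserves `S'_c`; restrict it to a derivation `δR` of `S'_c`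
  have hδmem : ∀ z ∈ centreLocalRing O S', (w • D) z ∈ centreLocalRing O S' := by
    intro z hz
    obtain ⟨a, b, ha, hb, hb0, hbi, hab⟩ := hpres z ((hmem z).mpr hz)
    rw [hwD, hw, mul_assoc, ← hgD, hab]
    exact (centreLocalRing O S').mul_mem hvinvR ((hmem _).mp ⟨a, b, ha, hb, hb0, hbi, rfl⟩)
  obtain ⟨δR, hδR'⟩ := exists_derivation_restrict (centreLocalRing O S').val.toRingHom
    Subtype.val_injective (w • D) fun z => ⟨⟨(w • D) z, hδmem z z.2⟩, rfl⟩
  have hδR : ∀ z : centreLocalRing O S', ((δR z : centreLocalRing O S') : K) = (w • D) z := hδR'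
  have hiter : ∀ (n : ℕ) (z : centreLocalRing O S'),
      (((⇑δR)^[n] z : centreLocalRing O S') : K) = (⇑(w • D))^[n] (z : K) := by
    intro n
    induction n with
    | zero => intro z; rfl
    | succ n ih =>
      intro z
      rw [Function.iterate_succ_apply', Function.iterate_succ_apply', hδR, ih]
  have hδRp : ∀ r : centreLocalRing O S', (⇑δR)^[p] r = 0 := fun r =>
    Subtype.ext (by rw [hiter, hnil, ZeroMemClass.coe_zero])
  have hδRx₀ : δR ⟨x₀, hx₀R⟩ = 1 := Subtype.ext (by rw [hδR, OneMemClass.coe_one]; exact hδx₀)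
  -- (5) the ring of constants of `δR` is regular (Taylor lemma + flat descent: the landed core)
  obtain ⟨S, hS⟩ := exists_subring_mem_iff δR
  have hSreg : IsRegularLocalRing S :=
    ConstantQuotientRegular.isRegularLocalRing_of_nilpotent p hδRx₀ S hS hδRp
  -- (6) `S = centreLocalRing O A` inside `K`
  have hAmem : ∀ z : K, z ∈ centreLocalRing O A ↔
      z ∈ centreLocalRing O S' ∧ (w • D) z = 0 := by
    intro z
    constructor
    · rintro ⟨a, ha, b, hb, hb1, rfl⟩
      obtain ⟨haS, hDa⟩ := (hchar a).mp ha
      obtain ⟨hbS, hDb⟩ := (hchar b).mp hb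
      refine ⟨⟨a, haS, b, hbS, hb1, rfl⟩, ?_⟩
      have hb0 : b ≠ 0 := ne_zero_of_valuation_eq_one hb1
      have h1 : D (a / b * b) = a / b * D b + b * D (a / b) := by
        rw [Derivation.leibniz, smul_eq_mul, smul_eq_mul]
      rw [div_mul_cancel₀ a hb0, hDa, hDb, mul_zero, zero_add] at h1
      rw [hwD, (mul_eq_zero.mp h1.symm).resolve_left hb0, mul_zero]
    · rintro ⟨⟨s, hs, t, ht, ht1, rfl⟩, hDz⟩
      have ht0 : t ≠ 0 := ne_zero_of_valuation_eq_one ht1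
      have hDz' : D (s / t) = 0 := by
        rw [hwD] at hDz
        exact (mul_eq_zero.mp hDz).resolve_left hwne
      have hDtp : D (t ^ p) = 0 := by
        rw [Derivation.leibniz_pow, nsmul_eq_mul, CharP.cast_eq_zero K p, zero_mul]
      have htpA : t ^ p ∈ A := (hchar _).mpr ⟨S'.pow_mem ht p, hDtp⟩
      have hztp : s / t * t ^ p ∈ A := by
        refine (hchar _).mpr ⟨?_, ?_⟩
        · obtain ⟨q, hq⟩ : ∃ q, p = q + 1 := ⟨p - 1, by omega⟩
          have h1 : s / t * t ^ p = s * t ^ q := by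
            rw [hq, pow_succ]
            calc s / t * (t ^ q * t) = s / t * t * t ^ q := by ring
              _ = s * t ^ q := by rw [div_mul_cancel₀ s ht0]
          rw [h1]
          exact S'.mul_mem hs (S'.pow_mem ht q)
        · rw [Derivation.leibniz, smul_eq_mul, smul_eq_mul, hDtp, hDz', mul_zero, mul_zero,
            add_zero]
      have htp1 : O.valuation (t ^ p) = 1 := by rw [map_pow, ht1, one_pow]
      have htp0 : t ^ p ≠ 0 := pow_ne_zero p ht0
      have h2 : s / t = s / t * t ^ p / t ^ p := by rw [mul_div_cancel_right₀ _ htp0]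
      rw [h2]
      exact div_mem_centreLocalRing hztp htpA htp1
  have hSmem : ∀ y : centreLocalRing O S', y ∈ S ↔ (w • D) (y : K) = 0 := fun y => by
    rw [hS]
    constructor
    · intro h
      rw [← hδR, h, ZeroMemClass.coe_zero]
    · intro h
      exact Subtype.ext (by rw [hδR, h, ZeroMemClass.coe_zero])
  -- (7) transport regularity along `S ≃+* centreLocalRing O A` and back to the localization
  let e : S ≃+* centreLocalRing O A :=
    { toFun := fun y => ⟨((y : centreLocalRing O S') : K),
        (hAmem _).mpr ⟨(y : centreLocalRing O S').2, (hSmem _).mp y.2⟩⟩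
      invFun := fun z => ⟨⟨(z : K), ((hAmem _).mp z.2).1⟩, (hSmem _).mpr ((hAmem _).mp z.2).2⟩
      left_inv := fun _ => rfl
      right_inv := fun _ => rfl
      map_mul' := fun _ _ => rfl
      map_add' := fun _ _ => rfl }
  haveI := hSreg
  exact (isRegularLocalRing_centre_iff A hA).mpr (IsRegularLocalRing.of_ringEquiv e)

end Summit.ResolutionOfSingularities.ResolutionOfSingularities.Theorems

end
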